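import Literature.Computability.Complexity.BISDownsets
import Literature.Computability.Complexity.BISDownsetsLemma9
import Literature.Computability.Complexity.OracleOneQuery
import Literature.Computability.Complexity.CodeFPArith
import Literature.Computability.Complexity.DirectedHamiltonCircuit
import HarnessLib

/-!
# `#DOWNSETS ≤_AP #BIS`: the transducer of Lemma 9 of Dyer–Goldberg–Greenhill–Jerrum (2003)

M. Dyer, L. A. Goldberg, C. Greenhill, M. Jerrum, *The relative complexity of approximate counting
problems*, Algorithmica 38 (2003) 471–500 (`DyerEtAl2003`; pages are those of the held preprint,
`lit paper:doi-10-1007-s00453-003-1073-y`), Lemma 9 (p. 11): "`#DOWNSETS ≤_AP #BIS`", with the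
accuracy bookkeeping "as in the proof of Theorem 3" (p. 6). This file DISCHARGES the named fact
`DyerEtAl2003.DownsetsAPReducibleBIS : APReducible downsetCount bisCount` of `BISDownsets.lean`
(`DownsetsAPReducibleBIS_holds`), i.e. it builds the oracle transducer that was left out there and
in `BISDownsetsLemma9.lean`, in the tree's algebra of `FP` string functions (`BrickAlgebra.lean`,
`FoldBricks.lean`, `CodeFP.lean`; no machine is programmed) and its transcript model of oracle
computation (`OracleOneQuery.lean`: `OracleAlg.oneQuery`).

## The printed proof and the tree form

Lemma 9 (p. 11): for `(X, ≼)`, `X = [n]`, blow every point `i` up into blocks `U_i`, `V_i` of size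
`2n`, join `U_i`–`V_j` completely iff `i ≼ j`; full independent sets of this bipartite graph `B`
are `(2^{2n} − 1)^n`-to-one over downsets and the non-full ones number at most
`3^n (2^{2n} − 1)^{n−1} < (2^{2n} − 1)^n / 4` (`n ≥ 5`), so `|𝓓(X, ≼)| = ⌊|𝓘(B)| / (2^{2n} − 1)^n⌋`
"and the result follows as in the proof of Theorem 3": ask the `#BIS` oracle once for `|𝓘(B)|`,
divide, round; p. 6: "we shall only apply the floor function in situations where its argument is
in the range `[N, N + 1/4]` … If `N ≤ 2/ε` … the result returned is exact. If `N > 2/ε`, then the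
result returned is in the range `[(N − 1/4)e^{−δ} − 1/2, (N + 1/4)e^{δ} + 1/2]`" (`δ = ε/21`).

The counting identities are already in the tree (`BISDownsetsBlowup.lean`: `card_indep_sub_lt`,
for an arbitrary reflexive relation and block size `m` with `4 · 3^n < 2^m − 1`;
`BISDownsetsLemma9.lean`: the `#BIS` instance `blowupFin M m` on `Fin (nm + nm)` of the reflexive
relation `matrixRel M` of an implication matrix, whose lower sets are the sets counted by
`downsetCount`). What is built here, mirroring the printed reduction:

* **Parsing on every string** (`decode_eq`). `downsetCount` is defined through
  `encodingNatMatrix.decode`, which accepts many non-canonical strings, so the transducer must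
  compute with the DECODED matrix of an arbitrary instance `x`: `decode x = some ⟨n, M⟩` iff the
  unary header of the entry list has length `n²` (`IsDec x`, `n = decodeNat (fst x)`), and then
  `M i j = decodeNat` of the item at position `j + n i` of the entries region (`matOf`, read by
  `nthItemFn`); undecodable instances count `0` and are answered `ε = bin 0`.
* **The query** (`queryW`, value `queryW_countQuery`): the sizes `n`, `m`, `nm`, `N = 2nm` and the
  accuracy in unary (`uN`, …, `uK`; the binary-to-unary conversion of `n` is capped by `|w|`, not
  active on decodable instances, `nCap_eq`), the adjacency bit of `blowupFin (matOf x) m` at a flat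
  index `K = J + N I` as a one-bit brick on the record `⟨w, 1ᴷ⟩` (`adjR`: sides `I / nm`, blocks
  `(I mod nm) / m`, the entry test `M j i ≠ 0`; `adjB_eq_true_iff`), tabulated by the concatenation
  fold `foldLoop appF` (`tabW_apply`, `N² ≤ 100 |w|²` rounds) into the code
  `⟨bin N, adjacency bits⟩ = encodingGraph.encode ⟨N, blowupFin (matOf x) m⟩` (`graphW_countQuery`),
  wrapped as the canonical counting query `⟨⟨y, ⟨1⁰, ⟨1ᵏ, 1¹⟩⟩⟩, ε⟩`.
* **The output** (`outZ`, `estim_codeFP`): the answer `a` is read through its canonical numeral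
  (`canonF a = bin (decodeNat a)`, the reading of `IsApproxCountRule`) and the estimate
  `⌊A (k+1) / (k (2^m − 1)^n)⌋` is a typed `CodeFP` program (`natPow`, `natMul`, `natDiv`).
* **The machine** `lemma9Alg = oneQuery 1 queryW ε outZ`: polynomial time
  (`isPolyTime_oneQuery`), its only query is `queryW w` (polynomially bounded, clause (i)), its
  rule-run takes two rounds (`lemma9Alg_runRule`); `APReducible.intro_of_forall` (coin-free).
* **The rounding step** (`estimate_isApproxCount`): `K D ≤ T`, `4 (T − K D) < K` and `A` within
  `1 + 1/k` of `T`, `k = 8 kη`, give `⌊A (k+1)/(k K)⌋` within `1 + 1/kη` of `D` — the paper's two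
  cases (`4D + 1 ≤ k`: exact from above; `4D ≥ k`: relative error).

Deviations from the printed text, all inessential: (1) block size `m = 2n + 3` instead of `2n`, so
that `4 · 3^n < 2^m − 1` holds for every `n` (`four_mul_three_pow_lt_mOf`) and the instances with
`n < 5` need no separate treatment; (2) the estimate inflates the answer by its tolerance and
rounds DOWN (lower bound for free) at oracle accuracy `1/(8 kη)`, where the paper rounds to the
nearest integer at `δ = ε/21`; (3) `downsetCount` counts the implication-closed sets of an
arbitrary `ℕ`-matrix (two-literal `#1P1NSAT`), handled through the reflexive relation `matrixRel`
(only reflexivity is used by the blow-up argument) rather than by contracting cyclic chains as in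
the proof of Theorem 5 (p. 9).

## References

* M. Dyer, L. A. Goldberg, C. Greenhill, M. Jerrum, *The relative complexity of approximate
  counting problems*, Algorithmica 38 (2003) 471–500, Lemma 9, Theorem 5, proof of Theorem 3
  [DyerEtAl2003].
* S. Arora, B. Barak, *Computational Complexity: A Modern Approach*, CUP 2009, §1.3 (polynomial
  time is closed under composition and bounded loops), §3.4 (oracle machines) [AroraBarak2009].

The tabulation follows the pattern of `DirectedHamiltonCircuit.lean` (Part 2, `DHamRed.tabF`),
whose generic lemmas `DHamRed.ccat_eq_ofFn`, `DHamRed.bool_eq_decide`, `DHamRed.ones_inj_iff`,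
`DHamRed.onesFn_eq` and `encodingGraphFin_encode_eq_ofFn` are reused (hence the import).
-/

noncomputable section

namespace Literature.Computability.Complexity

open _root_.Computability Polynomial Brick HashBricks Plumb OracleCompose Finset
open DHamRed (ones_inj_iff ccat_eq_ofFn bool_eq_decide)
open Com (ones_append)

namespace DyerEtAl2003

namespace Lemma9Machine

/-! ### Parsing an `ℕ`-matrix code on an arbitrary string -/

/-- The announced size `n = decodeNat (fst x)` of a purported matrix code `x`. [folklore] -/
def nOfX (x : List Bool) : ℕ := decodeNat (fstF x)

/-- The string of entry `(i, j)`: the first field after `j + n i` second projections of the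
entries region `snd (snd x)`. [folklore] -/
def entryStr (x : List Bool) (i j : ℕ) : List Bool :=
  fstF (sndF^[j + nOfX x * i] (sndF (sndF x)))

/-- The matrix read off `x`: entry `(i, j)` is `decodeNat` of its string. [folklore] -/
def matOf (x : List Bool) : Fin (nOfX x) → Fin (nOfX x) → ℕ :=
  fun i j => decodeNat (entryStr x i j)

/-- `x` decodes as a matrix code iff its unary length header has length `n²` (a predicate on
strings). [folklore] -/
def IsDec : List Bool → Prop := fun x => (fstF (sndF x)).length = nOfX x * nOfX x

/-- `IsDec` is decidable (an equality of numbers). [folklore] -/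
instance IsDec.decidable (x : List Bool) : Decidable (IsDec x) := inferInstanceAs (Decidable (_ = _))

/-- The fuel-indexed list decoder over `encodingNatBool` never fails and reads the iterated
projections. [folklore] -/
theorem listBoolDecode_natBool (k : ℕ) : ∀ W : List Bool,
    listBoolDecode encodingNatBool k W =
      some (List.ofFn fun i : Fin k => decodeNat (fstF (sndF^[(i : ℕ)] W))) := by
  induction k with
  | zero => intro W; rfl
  | succ k ih =>
    intro W
    have h1 : listBoolDecode encodingNatBool (k + 1) W =
        (listBoolDecode encodingNatBool k (sndF W)).bind
          fun l => some (decodeNat (fstF W) :: l) := rfl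
    rw [h1, ih (sndF W), List.ofFn_succ]
    rfl

/-- `decodeNat w = 0` exactly for the empty string. [folklore] -/
theorem decodeNat_eq_zero_iff (w : List Bool) : decodeNat w = 0 ↔ w = [] := by
  unfold decodeNat decodeNum
  split_ifs with h
  · simp [h]
  · simp only [h, iff_false]
    rw [PosNum.cast_to_num]
    exact (PosNum.cast_pos _).ne'

/-- **Decoding a purported matrix code**: success exactly on `IsDec`, with value
`⟨nOfX x, matOf x⟩`. [folklore] -/
theorem decode_eq (x : List Bool) :
    encodingNatMatrix.decode x = if IsDec x then some ⟨nOfX x, matOf x⟩ else none := by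
  have hlen : (List.ofFn fun i : Fin (fstF (sndF x)).length =>
      decodeNat (fstF (sndF^[(i : ℕ)] (sndF (sndF x))))).length = (fstF (sndF x)).length :=
    List.length_ofFn
  simp only [encodingNatMatrix, Encoding.sigmaBool, sigmaBoolDecode, encodingNatMatrixFin,
    Encoding.ofEquiv, encodingFinVec, Encoding.listBool]
  have e1 : unaryDecodeNat (boolUnpair (boolUnpair x).2).1 = (fstF (sndF x)).length := rfl
  have e2 : (boolUnpair (boolUnpair x).2).2 = sndF (sndF x) := rfl
  rw [e1, e2, listBoolDecode_natBool, Option.bind_some]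
  by_cases hd : IsDec x
  · have hc : (List.ofFn fun i : Fin (fstF (sndF x)).length =>
        decodeNat (fstF (sndF^[(i : ℕ)] (sndF (sndF x))))).length =
        decodeNat (boolUnpair x).1 * decodeNat (boolUnpair x).1 := hlen.trans hd
    rw [if_pos hd, dif_pos hc]
    simp only [Option.map_some, Option.some.injEq]
    congr 1
    funext i j
    simp [matOf, entryStr, nOfX, Equiv.arrowCongr, Equiv.curry, Function.curry, fstF, sndF]
  · have hc : ¬ (List.ofFn fun i : Fin (fstF (sndF x)).length =>
        decodeNat (fstF (sndF^[(i : ℕ)] (sndF (sndF x))))).length =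
        decodeNat (boolUnpair x).1 * decodeNat (boolUnpair x).1 := fun h' => hd (hlen.symm.trans h')
    rw [if_neg hd, dif_neg hc]
    rfl

/-! ### Small string facts -/

/-- `1ᵃ = ε ↔ a = 0`. [folklore] -/
theorem ones_eq_nil_iff (a : ℕ) : ones a = [] ↔ a = 0 := by
  rw [← ones_inj_iff]; rfl

/-- The counting query, written with `ones`. [folklore] -/
theorem countQuery_eq (x : List Bool) (kη kδ : ℕ) (u : List Bool) :
    countQuery x 0 kη kδ u = boolPair (boolPair x (boolPair [] (boolPair (ones kη) (ones kδ)))) u := by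
  simp only [countQuery, unaryEncodeNat_eq_replicate]
  rfl

/-- The parts of a string are shorter: `|fstF z| ≤ |z|`, `|sndF z| ≤ |z|`. [folklore] -/
theorem length_fstF_le (z : List Bool) : (fstF z).length ≤ z.length := by
  have := length_fstF_sndF_le z; omega

/-- `|sndF z| ≤ |z|`. [folklore] -/
theorem length_sndF_le (z : List Bool) : (sndF z).length ≤ z.length := by
  have := length_fstF_sndF_le z; omega

/-! ### Unary data read off the machine input `w = ⟨⟨x, ⟨1⁰, ⟨1^{kη}, 1^{kδ}⟩⟩⟩, u⟩` -/

/-- The instance `x` (first field of the first field). [folklore] -/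
def xW : List Bool → List Bool := fstF ∘ fstF

/-- The accuracy `1^{kη}` (field 2 of the first field). [folklore] -/
def kW : List Bool → List Bool := nthF 2 ∘ fstF

/-- The capped size `min n |w|` (the cap keeps the unary numeral short on junk inputs; on
decodable instances it is not active, `nCap_eq`). [folklore] -/
def nCap (w : List Bool) : ℕ := min (nOfX (xW w)) w.length

/-- `1^{nCap w}`: bounded binary-to-unary conversion of the canonical form of `fst x`, the ruler
being the whole input. [folklore] -/
def uN : List Bool → List Bool := binToUnaryFn ∘ fanoutFn id (canonF ∘ fstF ∘ xW)

/-- `1^{m}`, `m = 2 nCap + 3` (the block size). [folklore] -/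
def uM : List Bool → List Bool :=
  List.cons true ∘ List.cons true ∘ List.cons true ∘ fun z => uN z ++ uN z

/-- `1^{n m}` (the size of each side `U`, `V` of the blow-up). [folklore] -/
def uH : List Bool → List Bool := umulFn ∘ fanoutFn uN uM

/-- `1^{N}`, `N = nm + nm` (the number of vertices of the blow-up). [folklore] -/
def uV : List Bool → List Bool := fun z => uH z ++ uH z

/-- `1^{8 kη}` (the accuracy of the oracle call). [folklore] -/
def uK : List Bool → List Bool := umulFn ∘ fanoutFn (fun _ => ones 8) kW

/-- The validity test `[|fst (snd x)| = (nCap w)²]`. [folklore] -/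
def validW : List Bool → List Bool :=
  eqPairFn ∘ fanoutFn (onesFn ∘ fstF ∘ sndF ∘ xW) (umulFn ∘ fanoutFn uN uN)

/-- The block size. [folklore] -/
def mOf (n : ℕ) : ℕ := 2 * n + 3

/-- `xW ∈ FP`. [folklore] -/
theorem xW_mem_FP : xW ∈ FP := comp_mem_FP fstF_mem_FP fstF_mem_FP

/-- `kW ∈ FP`. [folklore] -/
theorem kW_mem_FP : kW ∈ FP := comp_mem_FP (nthF_mem_FP 2) fstF_mem_FP

/-- `uN ∈ FP`. [folklore] -/
theorem uN_mem_FP : uN ∈ FP :=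
  comp_mem_FP binToUnaryFn_mem_FP (fanoutFn_mem_FP id_mem_FP
    (comp_mem_FP canonF_mem_FP (comp_mem_FP fstF_mem_FP xW_mem_FP)))

/-- `uM ∈ FP`. [folklore] -/
theorem uM_mem_FP : uM ∈ FP :=
  comp_mem_FP (cons_mem_FP true) (comp_mem_FP (cons_mem_FP true) (comp_mem_FP (cons_mem_FP true)
    (append_mem_FP uN_mem_FP uN_mem_FP)))

/-- `uH ∈ FP`. [folklore] -/
theorem uH_mem_FP : uH ∈ FP := comp_mem_FP umulFn_mem_FP (fanoutFn_mem_FP uN_mem_FP uM_mem_FP)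

/-- `uV ∈ FP`. [folklore] -/
theorem uV_mem_FP : uV ∈ FP := append_mem_FP uH_mem_FP uH_mem_FP

/-- `uK ∈ FP`. [folklore] -/
theorem uK_mem_FP : uK ∈ FP := comp_mem_FP umulFn_mem_FP (fanoutFn_mem_FP (const_mem_FP _) kW_mem_FP)

/-- `validW ∈ FP`. [folklore] -/
theorem validW_mem_FP : validW ∈ FP :=
  comp_mem_FP eqPairFn_mem_FP (fanoutFn_mem_FP
    (comp_mem_FP onesFn_mem_FP (comp_mem_FP fstF_mem_FP (comp_mem_FP sndF_mem_FP xW_mem_FP)))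
    (comp_mem_FP umulFn_mem_FP (fanoutFn_mem_FP uN_mem_FP uN_mem_FP)))

/-- Value of `uN`. [folklore] -/
@[simp] theorem uN_apply (w : List Bool) : uN w = ones (nCap w) := by
  simp only [uN, Function.comp_apply, fanoutFn_apply, id, binToUnaryFn_boolPair, bitsToNat_canonF]
  rfl

/-- Value of `uM`. [folklore] -/
@[simp] theorem uM_apply (w : List Bool) : uM w = ones (mOf (nCap w)) := by
  simp only [uM, Function.comp_apply, uN_apply, ones_append, mOf]
  rw [show 2 * nCap w + 3 = (nCap w + nCap w) + 1 + 1 + 1 by ring]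
  simp [ones, List.replicate_succ]

/-- Value of `uH`. [folklore] -/
@[simp] theorem uH_apply (w : List Bool) : uH w = ones (nCap w * mOf (nCap w)) := by
  simp [uH]

/-- Value of `uV`. [folklore] -/
@[simp] theorem uV_apply (w : List Bool) :
    uV w = ones (nCap w * mOf (nCap w) + nCap w * mOf (nCap w)) := by
  simp [uV]

/-- Value of `validW`. [folklore] -/
theorem validW_apply (w : List Bool) :
    validW w = [decide ((fstF (sndF (xW w))).length = nCap w * nCap w)] := by
  simp only [validW, Function.comp_apply, fanoutFn_apply, eqPairFn_boolPair, DHamRed.onesFn_eq, uN_apply,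
    umulFn_boolPair, ones_inj_iff]

/-- `validW` is one-bit. [folklore] -/
theorem oneBit_validW : OneBit validW := fun w => ⟨_, validW_apply w⟩

section Query

variable (x : List Bool) (kη kδ : ℕ) (u : List Bool)

/-- `xW` on a counting query. [folklore] -/
@[simp] theorem xW_countQuery : xW (countQuery x 0 kη kδ u) = x := by
  simp [xW, countQuery_eq]

/-- `kW` on a counting query. [folklore] -/
@[simp] theorem kW_countQuery : kW (countQuery x 0 kη kδ u) = ones kη := by
  simp [kW, countQuery_eq]

/-- Value of `uK` on a counting query. [folklore] -/
@[simp] theorem uK_countQuery : uK (countQuery x 0 kη kδ u) = ones (8 * kη) := by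
  simp [uK]

/-- A counting query is longer than its instance: `|x| + 2 ≤ |w|`. [folklore] -/
theorem length_countQuery_ge : x.length + 2 ≤ (countQuery x 0 kη kδ u).length := by
  rw [countQuery_eq, length_boolPair, length_boolPair]
  omega

/-- The entries header is shorter than the instance: `|fstF (sndF x)| ≤ |x|`. [folklore] -/
theorem length_header_le : (fstF (sndF x)).length ≤ x.length :=
  (length_fstF_le _).trans (length_sndF_le _)

variable {x}

/-- **On a decodable instance the cap is not active**: `nCap w = n`. [folklore] -/
theorem nCap_eq (h : IsDec x) : nCap (countQuery x 0 kη kδ u) = nOfX x := by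
  rw [nCap, xW_countQuery]
  refine min_eq_left ?_
  have h1 := length_countQuery_ge x kη kδ u
  have h2 := length_header_le x
  unfold IsDec at h
  rcases Nat.eq_zero_or_pos (nOfX x) with h0 | hpos
  · omega
  · nlinarith

/-- **The validity test decides decodability.** [folklore] -/
theorem validW_countQuery : validW (countQuery x 0 kη kδ u) = [decide (IsDec x)] := by
  rw [validW_apply, xW_countQuery]
  congr 1
  rw [decide_eq_decide]
  constructor
  · intro hv
    -- if the cap were active, the header would be as long as `|w|²`
    have h1 := length_countQuery_ge x kη kδ u
    have h2 := length_header_le x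
    unfold IsDec
    rw [hv, nCap, xW_countQuery]
    rcases le_or_gt (nOfX x) (countQuery x 0 kη kδ u).length with hle | hlt
    · rw [min_eq_left hle]
    · exfalso
      rw [nCap, xW_countQuery, min_eq_right hlt.le] at hv
      nlinarith
  · intro hd
    rw [nCap_eq kη kδ u hd]
    exact hd

end Query


/-! ### The adjacency bit of the blow-up at a flat index: bricks on the record `⟨w, 1ᴷ⟩` -/

section Record

/-- `⟨1^{K / N}, 1^{K mod N}⟩ = ⟨1^I, 1^J⟩`: row and column of the flat index. [folklore] -/
def ijR : List Bool → List Bool := divModFn ∘ fanoutFn (uV ∘ fstF) sndF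
/-- `⟨1^{I / nm}, 1^{I mod nm}⟩`: side and position of the row vertex. [folklore] -/
def iSR : List Bool → List Bool := divModFn ∘ fanoutFn (uH ∘ fstF) (fstF ∘ ijR)
/-- `⟨1^{J / nm}, 1^{J mod nm}⟩`: side and position of the column vertex. [folklore] -/
def jSR : List Bool → List Bool := divModFn ∘ fanoutFn (uH ∘ fstF) (sndF ∘ ijR)
/-- The side `1^{I / nm}` of the row vertex. [folklore] -/
def sIR : List Bool → List Bool := fstF ∘ iSR
/-- The side `1^{J / nm}` of the column vertex. [folklore] -/
def sJR : List Bool → List Bool := fstF ∘ jSR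
/-- The block `1^{(I mod nm) / m}` of the row vertex. [folklore] -/
def bIR : List Bool → List Bool := fstF ∘ divModFn ∘ fanoutFn (uM ∘ fstF) (sndF ∘ iSR)
/-- The block `1^{(J mod nm) / m}` of the column vertex. [folklore] -/
def bJR : List Bool → List Bool := fstF ∘ divModFn ∘ fanoutFn (uM ∘ fstF) (sndF ∘ jSR)
/-- Equality test of two unary fields. [folklore] -/
def eqR (f g : List Bool → List Bool) : List Bool → List Bool := eqPairFn ∘ fanoutFn f g
/-- **The entry test** `[entry (|f|, |g|) of x is nonzero]`: the item at position `|g| + n |f|` of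
the entries region `snd (snd x)` is a nonempty string. [folklore] -/
def entR (f g : List Bool → List Bool) : List Bool → List Bool :=
  notFn (isNilFn ∘ nthItemFn ∘
    fanoutFn (appF ∘ fanoutFn g (umulFn ∘ fanoutFn (uN ∘ fstF) f)) (sndF ∘ sndF ∘ xW ∘ fstF))

/-- **The adjacency bit**: the two vertices lie on different sides, and their blocks `i` (on `U`)
and `j` (on `V`) satisfy `i ≼ j`, i.e. `i = j ∨ M j i ≠ 0`. [cite: DyerEtAl2003, Lemma 9 (proof)] -/
def adjR : List Bool → List Bool :=
  andFn (notFn (eqR sIR sJR))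
    (orFn (eqR bIR bJR)
      (orFn (andFn (isNilFn ∘ sIR) (entR bJR bIR)) (andFn (notFn (isNilFn ∘ sIR)) (entR bIR bJR))))

/-! #### Membership in `FP` and one-bit outputs -/

/-- `ijR ∈ FP`. [folklore] -/
theorem ijR_mem_FP : ijR ∈ FP :=
  comp_mem_FP divModFn_mem_FP (fanoutFn_mem_FP (comp_mem_FP uV_mem_FP fstF_mem_FP) sndF_mem_FP)
/-- `iSR ∈ FP`. [folklore] -/
theorem iSR_mem_FP : iSR ∈ FP :=
  comp_mem_FP divModFn_mem_FP (fanoutFn_mem_FP (comp_mem_FP uH_mem_FP fstF_mem_FP) (comp_mem_FP fstF_mem_FP ijR_mem_FP))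
/-- `jSR ∈ FP`. [folklore] -/
theorem jSR_mem_FP : jSR ∈ FP :=
  comp_mem_FP divModFn_mem_FP (fanoutFn_mem_FP (comp_mem_FP uH_mem_FP fstF_mem_FP) (comp_mem_FP sndF_mem_FP ijR_mem_FP))
/-- `sIR ∈ FP`. [folklore] -/
theorem sIR_mem_FP : sIR ∈ FP := comp_mem_FP fstF_mem_FP iSR_mem_FP
/-- `sJR ∈ FP`. [folklore] -/
theorem sJR_mem_FP : sJR ∈ FP := comp_mem_FP fstF_mem_FP jSR_mem_FP
/-- `bIR ∈ FP`. [folklore] -/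
theorem bIR_mem_FP : bIR ∈ FP :=
  comp_mem_FP fstF_mem_FP (comp_mem_FP divModFn_mem_FP
    (fanoutFn_mem_FP (comp_mem_FP uM_mem_FP fstF_mem_FP) (comp_mem_FP sndF_mem_FP iSR_mem_FP)))
/-- `bJR ∈ FP`. [folklore] -/
theorem bJR_mem_FP : bJR ∈ FP :=
  comp_mem_FP fstF_mem_FP (comp_mem_FP divModFn_mem_FP
    (fanoutFn_mem_FP (comp_mem_FP uM_mem_FP fstF_mem_FP) (comp_mem_FP sndF_mem_FP jSR_mem_FP)))
/-- `eqR f g ∈ FP`. [folklore] -/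
theorem eqR_mem_FP {f g : List Bool → List Bool} (hf : f ∈ FP) (hg : g ∈ FP) : eqR f g ∈ FP :=
  comp_mem_FP eqPairFn_mem_FP (fanoutFn_mem_FP hf hg)
/-- `entR f g ∈ FP`. [folklore] -/
theorem entR_mem_FP {f g : List Bool → List Bool} (hf : f ∈ FP) (hg : g ∈ FP) : entR f g ∈ FP :=
  notFn_mem_FP (comp_mem_FP isNilFn_mem_FP (comp_mem_FP nthItemFn_mem_FP (fanoutFn_mem_FP
    (comp_mem_FP appF_mem_FP (fanoutFn_mem_FP hg (comp_mem_FP umulFn_mem_FP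
      (fanoutFn_mem_FP (comp_mem_FP uN_mem_FP fstF_mem_FP) hf))))
    (comp_mem_FP sndF_mem_FP (comp_mem_FP sndF_mem_FP (comp_mem_FP xW_mem_FP fstF_mem_FP))))))

/-- **`adjR ∈ FP`.** [folklore] -/
theorem adjR_mem_FP : adjR ∈ FP :=
  andFn_mem_FP (notFn_mem_FP (eqR_mem_FP sIR_mem_FP sJR_mem_FP))
    (orFn_mem_FP (eqR_mem_FP bIR_mem_FP bJR_mem_FP)
      (orFn_mem_FP (andFn_mem_FP (comp_mem_FP isNilFn_mem_FP sIR_mem_FP) (entR_mem_FP bJR_mem_FP bIR_mem_FP))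
        (andFn_mem_FP (notFn_mem_FP (comp_mem_FP isNilFn_mem_FP sIR_mem_FP)) (entR_mem_FP bIR_mem_FP bJR_mem_FP))))

/-- `eqR f g` is one-bit. [folklore] -/
theorem oneBit_eqR (f g : List Bool → List Bool) : OneBit (eqR f g) := fun z =>
  ⟨_, by rw [eqR, Function.comp_apply, fanoutFn_apply, eqPairFn_boolPair]⟩

/-- `entR f g` is one-bit. [folklore] -/
theorem oneBit_entR (f g : List Bool → List Bool) : OneBit (entR f g) :=
  oneBit_notFn (oneBit_isNilFn.comp _)

/-- **`adjR` is one-bit.** [folklore] -/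
theorem oneBit_adjR : OneBit adjR :=
  oneBit_andFn (oneBit_notFn (oneBit_eqR _ _))
    (oneBit_orFn (oneBit_eqR _ _)
      (oneBit_orFn (oneBit_andFn (oneBit_isNilFn.comp _) (oneBit_entR _ _))
        (oneBit_andFn (oneBit_notFn (oneBit_isNilFn.comp _)) (oneBit_entR _ _))))

/-! #### Values on a record `⟨w, 1ᴷ⟩` -/

/-- **The adjacency predicate on numerical data**: sides `I / h`, `J / h` (`h = nm`), blocks
`(I mod h) / m`, `(J mod h) / m`, entries read by `E`. [cite: DyerEtAl2003, Lemma 9 (proof)] -/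
def adjB (h m : ℕ) (E : ℕ → ℕ → Bool) (I J : ℕ) : Bool :=
  (!decide (I / h = J / h)) &&
    (decide (I % h / m = J % h / m) ||
      (decide (I / h = 0) && E (J % h / m) (I % h / m) || (!decide (I / h = 0) && E (I % h / m) (J % h / m))))

variable (w : List Bool) (K : ℕ)

/-- Value of `ijR`. [folklore] -/
@[simp] theorem ijR_rec : ijR (boolPair w (ones K)) =
    boolPair (ones (K / (nCap w * mOf (nCap w) + nCap w * mOf (nCap w))))
      (ones (K % (nCap w * mOf (nCap w) + nCap w * mOf (nCap w)))) := by
  simp [ijR]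

/-- Value of `sIR`. [folklore] -/
@[simp] theorem sIR_rec : sIR (boolPair w (ones K)) =
    ones (K / (nCap w * mOf (nCap w) + nCap w * mOf (nCap w)) / (nCap w * mOf (nCap w))) := by
  simp [sIR, iSR]

/-- Value of `sJR`. [folklore] -/
@[simp] theorem sJR_rec : sJR (boolPair w (ones K)) =
    ones (K % (nCap w * mOf (nCap w) + nCap w * mOf (nCap w)) / (nCap w * mOf (nCap w))) := by
  simp [sJR, jSR]

/-- Value of `bIR`. [folklore] -/
@[simp] theorem bIR_rec : bIR (boolPair w (ones K)) =
    ones (K / (nCap w * mOf (nCap w) + nCap w * mOf (nCap w)) % (nCap w * mOf (nCap w)) / mOf (nCap w)) := by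
  simp [bIR, iSR]

/-- Value of `bJR`. [folklore] -/
@[simp] theorem bJR_rec : bJR (boolPair w (ones K)) =
    ones (K % (nCap w * mOf (nCap w) + nCap w * mOf (nCap w)) % (nCap w * mOf (nCap w)) / mOf (nCap w)) := by
  simp [bJR, jSR]

/-- Value of an equality test of two unary fields. [folklore] -/
theorem eqR_rec_of {f g : List Bool → List Bool} {z : List Bool} {a b : ℕ} (hf : f z = ones a)
    (hg : g z = ones b) : eqR f g z = [decide (a = b)] := by
  rw [eqR, Function.comp_apply, fanoutFn_apply, hf, hg, eqPairFn_boolPair]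
  simp only [ones_inj_iff]

/-- Value of a nil test of a unary field. [folklore] -/
theorem isNil_rec_of {f : List Bool → List Bool} {z : List Bool} {a : ℕ} (hf : f z = ones a) :
    (isNilFn ∘ f) z = [decide (a = 0)] := by
  rw [Function.comp_apply, hf, isNilFn]
  simp only [ones_eq_nil_iff]

/-- The nonzero-entry test on numerical indices of `x` (entries region `snd (snd x)`, row length
`n`). [folklore] -/
def entB (x : List Bool) (n i j : ℕ) : Bool :=
  !decide (fstF (sndF^[j + n * i] (sndF (sndF x))) = [])

/-- Value of the entry test. [folklore] -/
theorem entR_rec_of {f g : List Bool → List Bool} {a b : ℕ} (hf : f (boolPair w (ones K)) = ones a)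
    (hg : g (boolPair w (ones K)) = ones b) :
    entR f g (boolPair w (ones K)) = [entB (xW w) (nCap w) a b] := by
  have h : (isNilFn ∘ nthItemFn ∘ fanoutFn (appF ∘ fanoutFn g (umulFn ∘ fanoutFn (uN ∘ fstF) f))
      (sndF ∘ sndF ∘ xW ∘ fstF)) (boolPair w (ones K)) =
      [decide (fstF (sndF^[b + nCap w * a] (sndF (sndF (xW w)))) = [])] := by
    simp only [Function.comp_apply, fanoutFn_apply, hf, hg, fstF_boolPair, uN_apply, umulFn_boolPair,
      appF_boolPair, ones_append, nthItemFn_boolPair, List.length_replicate, isNilFn]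
  rw [entR, notFn_apply h, entB]

/-- **Value of the adjacency bit on a record.** [cite: DyerEtAl2003, Lemma 9 (proof)] -/
theorem adjR_rec : adjR (boolPair w (ones K)) =
    [adjB (nCap w * mOf (nCap w)) (mOf (nCap w)) (entB (xW w) (nCap w))
      (K / (nCap w * mOf (nCap w) + nCap w * mOf (nCap w)))
      (K % (nCap w * mOf (nCap w) + nCap w * mOf (nCap w)))] := by
  rw [adjR, andFn_apply (notFn_apply (eqR_rec_of (sIR_rec w K) (sJR_rec w K)))
    (orFn_apply (eqR_rec_of (bIR_rec w K) (bJR_rec w K))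
      (orFn_apply (andFn_apply (isNil_rec_of (sIR_rec w K)) (entR_rec_of w K (bJR_rec w K) (bIR_rec w K)))
        (andFn_apply (notFn_apply (isNil_rec_of (sIR_rec w K))) (entR_rec_of w K (bIR_rec w K) (bJR_rec w K))))),
    adjB]

end Record

/-! ### Tabulating the adjacency bits; the query -/

/-- The number of output bits `N²` in binary. [folklore] -/
def cntW : List Bool → List Bool := lenBinF ∘ umulFn ∘ fanoutFn uV uV

/-- Value of `cntW`. [folklore] -/
@[simp] theorem cntW_apply (w : List Bool) :
    cntW w = encodeNat ((nCap w * mOf (nCap w) + nCap w * mOf (nCap w)) *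
      (nCap w * mOf (nCap w) + nCap w * mOf (nCap w))) := by
  simp [cntW]

/-- `cntW ∈ FP`. [folklore] -/
theorem cntW_mem_FP : cntW ∈ FP :=
  comp_mem_FP lenBinF_mem_FP (comp_mem_FP umulFn_mem_FP (fanoutFn_mem_FP uV_mem_FP uV_mem_FP))

/-- The initial record `⟨w, ⟨bin N², ⟨1⁰, ε⟩⟩⟩` of the tabulation loop. [folklore] -/
def initW : List Bool → List Bool := fanoutFn id (fanoutFn cntW fun _ => boolPair [] [])

/-- `initW ∈ FP`. [folklore] -/
theorem initW_mem_FP : initW ∈ FP :=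
  fanoutFn_mem_FP id_mem_FP (fanoutFn_mem_FP cntW_mem_FP (const_mem_FP _))

/-- **The tabulation** of the adjacency bits: the concatenation fold of `adjR` over the flat
indices `K < N²` (`N² ≤ 100 |w|²` rounds available). [folklore] -/
def tabW : List Bool → List Bool := sndPow 2 ∘ foldLoop appF adjR (C 100 * X ^ 2) ∘ initW

/-- **`tabW ∈ FP`.** [folklore] -/
theorem tabW_mem_FP : tabW ∈ FP :=
  comp_mem_FP (sndPow_mem_FP 2) (comp_mem_FP
    (foldLoop_mem_FP appF_mem_FP length_appF_le adjR_mem_FP (C := 1)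
      (fun z => by rw [oneBit_adjR.length_eq]; omega) (C 100 * X ^ 2))
    initW_mem_FP)

/-- **Value of the tabulation** when `N² ≤ 100 |w|²`: the list of adjacency bits at the flat
indices. [folklore] -/
theorem tabW_apply (w : List Bool)
    (hN : (nCap w * mOf (nCap w) + nCap w * mOf (nCap w)) *
      (nCap w * mOf (nCap w) + nCap w * mOf (nCap w)) ≤ 100 * w.length ^ 2) :
    tabW w = List.ofFn fun K : Fin ((nCap w * mOf (nCap w) + nCap w * mOf (nCap w)) *
        (nCap w * mOf (nCap w) + nCap w * mOf (nCap w))) =>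
      adjB (nCap w * mOf (nCap w)) (mOf (nCap w)) (entB (xW w) (nCap w))
        (K / (nCap w * mOf (nCap w) + nCap w * mOf (nCap w)))
        (K % (nCap w * mOf (nCap w) + nCap w * mOf (nCap w))) := by
  have hk : (nCap w * mOf (nCap w) + nCap w * mOf (nCap w)) *
      (nCap w * mOf (nCap w) + nCap w * mOf (nCap w)) ≤ (C 100 * X ^ 2 : ℕ[X]).eval w.length := by
    simpa using hN
  have hinit : initW w = boolPair w (boolPair (encodeNat ((nCap w * mOf (nCap w) + nCap w * mOf (nCap w)) *
      (nCap w * mOf (nCap w) + nCap w * mOf (nCap w)))) (boolPair (ones 0) [])) := by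
    simp [initW]
  rw [tabW, Function.comp_apply, Function.comp_apply, hinit, foldLoop_apply appF adjR hk 0 [],
    sndPow_succ_boolPair, sndPow_succ_boolPair, sndPow_zero_boolPair, foldAcc_appF, List.nil_append]
  refine ccat_eq_ofFn fun j hj => ?_
  rw [Nat.zero_add, adjR_rec]

/-- **The `#BIS` instance**: `⟨bin N, adjacency bits⟩`. [cite: DyerEtAl2003, Lemma 9 (proof)] -/
def graphW : List Bool → List Bool := fanoutFn (lenBinF ∘ uV) tabW

/-- `graphW ∈ FP`. [folklore] -/
theorem graphW_mem_FP : graphW ∈ FP :=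
  fanoutFn_mem_FP (comp_mem_FP lenBinF_mem_FP uV_mem_FP) tabW_mem_FP

/-- **The oracle query** `⟨⟨y, ⟨1⁰, ⟨1^{8kη}, 1¹⟩⟩⟩, ε⟩` (the canonical counting query for the
`#BIS` instance `y` at accuracy `8 kη`). [cite: DyerEtAl2003, Lemma 9 (proof)] -/
def queryW : List Bool → List Bool :=
  fanoutFn (fanoutFn graphW (fanoutFn (fun _ => []) (fanoutFn uK fun _ => [true]))) fun _ => []

/-- `queryW ∈ FP`. [folklore] -/
theorem queryW_mem_FP : queryW ∈ FP :=
  fanoutFn_mem_FP (fanoutFn_mem_FP graphW_mem_FP (fanoutFn_mem_FP (const_mem_FP _)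
    (fanoutFn_mem_FP uK_mem_FP (const_mem_FP _)))) (const_mem_FP _)


/-! ### The tabulated bits are the adjacency bits of `blowupFin` -/

section Adjacency

variable {n : ℕ} (M : Fin n → Fin n → ℕ) (m : ℕ)

/-- The label of a `U`-vertex: `(i, a) ↦ a + m i`. [folklore] -/
theorem blowupFinEquiv_inl_val (i : Fin n) (a : Fin m) :
    ((blowupFinEquiv n m (Sum.inl (i, a)) : Fin (n * m + n * m)) : ℕ) = a + m * i := by
  simp [blowupFinEquiv]

/-- The label of a `V`-vertex: `(j, b) ↦ nm + (b + m j)`. [folklore] -/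
theorem blowupFinEquiv_inr_val (j : Fin n) (b : Fin m) :
    ((blowupFinEquiv n m (Sum.inr (j, b)) : Fin (n * m + n * m)) : ℕ) = n * m + (b + m * j) := by
  simp [blowupFinEquiv]; omega

/-- Adjacency of `blowupFin` at labelled vertices is adjacency of the blow-up. [folklore] -/
theorem blowupFin_adj_iff (v w : BlowupVertex (Fin n) m) :
    (blowupFin M m).Adj (blowupFinEquiv n m v) (blowupFinEquiv n m w) ↔ blowupAdj (matrixRel M) m v w := by
  simp [blowupFin, SimpleGraph.comap_adj]

variable {m}

/-- A label below `nm` is a `U`-vertex `(I / m, I mod m)`. [folklore] -/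
theorem exists_inl_of_lt {I : ℕ} (hI : I < n * m) :
    ∃ (i : Fin n) (a : Fin m), (blowupFinEquiv n m (Sum.inl (i, a)) : ℕ) = I ∧ (i : ℕ) = I / m := by
  have hm : 0 < m := Nat.pos_of_ne_zero fun h0 => by simp [h0] at hI
  refine ⟨⟨I / m, Nat.div_lt_of_lt_mul (by rw [Nat.mul_comm m n]; exact hI)⟩, ⟨I % m, Nat.mod_lt _ hm⟩, ?_, rfl⟩
  rw [blowupFinEquiv_inl_val]
  exact Nat.mod_add_div I m

/-- A label `nm ≤ I < 2nm` is a `V`-vertex `((I - nm) / m, (I - nm) mod m)`. [folklore] -/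
theorem exists_inr_of_le {I : ℕ} (h1 : n * m ≤ I) (h2 : I < n * m + n * m) :
    ∃ (j : Fin n) (b : Fin m), (blowupFinEquiv n m (Sum.inr (j, b)) : ℕ) = I ∧ (j : ℕ) = (I - n * m) / m := by
  have hm : 0 < m := Nat.pos_of_ne_zero fun h0 => by simp [h0] at h2
  have hlt : I - n * m < n * m := by omega
  refine ⟨⟨(I - n * m) / m, Nat.div_lt_of_lt_mul (by rw [Nat.mul_comm m n]; exact hlt)⟩,
    ⟨(I - n * m) % m, Nat.mod_lt _ hm⟩, ?_, rfl⟩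
  rw [blowupFinEquiv_inr_val]
  have := Nat.mod_add_div (I - n * m) m
  show n * m + ((I - n * m) % m + m * ((I - n * m) / m)) = I
  omega

end Adjacency

section Decodable

variable {x : List Bool}

/-- The entry test reads `M j i ≠ 0` for the decoded matrix `M = matOf x`. [folklore] -/
theorem entB_eq (i j : Fin (nOfX x)) :
    entB x (nOfX x) i j = decide (matOf x i j ≠ 0) := by
  rw [entB, matOf, entryStr]
  simp only [ne_eq, decodeNat_eq_zero_iff, decide_not]

/-- **`adjB` computes adjacency in `blowupFin (matOf x) m`.** [cite: DyerEtAl2003, Lemma 9 (proof)] -/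
theorem adjB_eq_true_iff (m : ℕ) {I J : ℕ} (hI : I < nOfX x * m + nOfX x * m)
    (hJ : J < nOfX x * m + nOfX x * m) :
    adjB (nOfX x * m) m (entB x (nOfX x)) I J = true ↔
      (blowupFin (matOf x) m).Adj ⟨I, hI⟩ ⟨J, hJ⟩ := by
  -- sides and positions
  have side0 : ∀ {L : ℕ}, L < nOfX x * m → L / (nOfX x * m) = 0 ∧ L % (nOfX x * m) = L := fun hL =>
    ⟨Nat.div_eq_of_lt hL, Nat.mod_eq_of_lt hL⟩
  have side1 : ∀ {L : ℕ}, nOfX x * m ≤ L → L < nOfX x * m + nOfX x * m →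
      L / (nOfX x * m) = 1 ∧ L % (nOfX x * m) = L - nOfX x * m := fun hL hL' =>
    ⟨Nat.div_eq_of_lt_le (by omega) (by omega),
      by rw [Nat.mod_eq_sub_mod hL, Nat.mod_eq_of_lt (by omega)]⟩
  rcases lt_or_ge I (nOfX x * m) with hIl | hIg <;> rcases lt_or_ge J (nOfX x * m) with hJl | hJg
  · -- both on `U`
    obtain ⟨i, a, hi, -⟩ := exists_inl_of_lt hIl
    obtain ⟨j, b, hj, -⟩ := exists_inl_of_lt hJl
    have e1 : (⟨I, hI⟩ : Fin _) = blowupFinEquiv (nOfX x) m (Sum.inl (i, a)) := Fin.ext hi.symm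
    have e2 : (⟨J, hJ⟩ : Fin _) = blowupFinEquiv (nOfX x) m (Sum.inl (j, b)) := Fin.ext hj.symm
    rw [e1, e2, blowupFin_adj_iff]
    simp [adjB, (side0 hIl).1, (side0 hJl).1]
  · -- `U`–`V`
    obtain ⟨i, a, hi, hiv⟩ := exists_inl_of_lt hIl
    obtain ⟨j, b, hj, hjv⟩ := exists_inr_of_le hJg hJ
    have e1 : (⟨I, hI⟩ : Fin _) = blowupFinEquiv (nOfX x) m (Sum.inl (i, a)) := Fin.ext hi.symm
    have e2 : (⟨J, hJ⟩ : Fin _) = blowupFinEquiv (nOfX x) m (Sum.inr (j, b)) := Fin.ext hj.symm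
    rw [e1, e2, blowupFin_adj_iff, blowupAdj_inl_inr, matrixRel]
    simp only [adjB, (side0 hIl).1, (side0 hIl).2, (side1 hJg hJ).1, (side1 hJg hJ).2, ← hiv, ← hjv,
      entB_eq]
    simp [Fin.ext_iff]
  · -- `V`–`U`
    obtain ⟨i, a, hi, hiv⟩ := exists_inr_of_le hIg hI
    obtain ⟨j, b, hj, hjv⟩ := exists_inl_of_lt hJl
    have e1 : (⟨I, hI⟩ : Fin _) = blowupFinEquiv (nOfX x) m (Sum.inr (i, a)) := Fin.ext hi.symm
    have e2 : (⟨J, hJ⟩ : Fin _) = blowupFinEquiv (nOfX x) m (Sum.inl (j, b)) := Fin.ext hj.symm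
    rw [e1, e2, blowupFin_adj_iff, blowupAdj_inr_inl, matrixRel]
    simp only [adjB, (side1 hIg hI).1, (side1 hIg hI).2, (side0 hJl).1, (side0 hJl).2, ← hiv, ← hjv,
      entB_eq]
    rw [@eq_comm _ j i]
    simp [Fin.ext_iff]
  · -- both on `V`
    obtain ⟨i, a, hi, -⟩ := exists_inr_of_le hIg hI
    obtain ⟨j, b, hj, -⟩ := exists_inr_of_le hJg hJ
    have e1 : (⟨I, hI⟩ : Fin _) = blowupFinEquiv (nOfX x) m (Sum.inr (i, a)) := Fin.ext hi.symm
    have e2 : (⟨J, hJ⟩ : Fin _) = blowupFinEquiv (nOfX x) m (Sum.inr (j, b)) := Fin.ext hj.symm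
    rw [e1, e2, blowupFin_adj_iff]
    simp [adjB, (side1 hIg hI).1, (side1 hJg hJ).1]

variable (kη kδ : ℕ) (u : List Bool)

/-- The size bound making the tabulation budget sufficient: `N² ≤ 100 |w|²`. [folklore] -/
theorem sq_le_of_isDec (hd : IsDec x) :
    (nOfX x * mOf (nOfX x) + nOfX x * mOf (nOfX x)) * (nOfX x * mOf (nOfX x) + nOfX x * mOf (nOfX x)) ≤
      100 * (countQuery x 0 kη kδ u).length ^ 2 := by
  have h1 := length_countQuery_ge x kη kδ u
  have h2 := length_header_le x
  unfold IsDec at hd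
  set n := nOfX x
  set L := (countQuery x 0 kη kδ u).length
  have hnL : n * n ≤ L := by omega
  have h3 : n ^ 4 ≤ L ^ 2 := by nlinarith
  have h4 : (n * mOf n + n * mOf n) * (n * mOf n + n * mOf n) ≤ 100 * n ^ 4 := by
    rcases Nat.eq_zero_or_pos n with h0 | hp
    · simp [h0]
    · have : n ^ 2 ≤ n ^ 4 := Nat.pow_le_pow_right hp (by norm_num)
      have : n ^ 3 ≤ n ^ 4 := Nat.pow_le_pow_right hp (by norm_num)
      simp only [mOf]; nlinarith
  nlinarith

/-- **Value of the `#BIS` instance on a decodable input**: the code of the blow-up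
`blowupFin (matOf x) (2n+3)`. [cite: DyerEtAl2003, Lemma 9 (proof)] -/
theorem graphW_countQuery (hd : IsDec x) :
    graphW (countQuery x 0 kη kδ u) =
      encodingGraph.encode ⟨nOfX x * mOf (nOfX x) + nOfX x * mOf (nOfX x), blowupFin (matOf x) (mOf (nOfX x))⟩ := by
  classical
  have hn := nCap_eq kη kδ u hd
  have htab := tabW_apply (countQuery x 0 kη kδ u) (by rw [hn]; exact sq_le_of_isDec kη kδ u hd)
  rw [hn, xW_countQuery] at htab
  rw [graphW, fanoutFn_apply, Function.comp_apply, uV_apply, lenBinF_apply, List.length_replicate, hn, htab,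
    encodingGraph_encode]
  dsimp only
  rw [encodingGraphFin_encode_eq_ofFn]
  congr 1
  refine congrArg List.ofFn (funext fun k => bool_eq_decide ?_)
  have hk : (k : ℕ) < (nOfX x * mOf (nOfX x) + nOfX x * mOf (nOfX x)) *
      (nOfX x * mOf (nOfX x) + nOfX x * mOf (nOfX x)) := k.2
  have hpos : 0 < nOfX x * mOf (nOfX x) + nOfX x * mOf (nOfX x) := Nat.pos_of_ne_zero fun h0 => by
    have : (nOfX x * mOf (nOfX x) + nOfX x * mOf (nOfX x)) *
        (nOfX x * mOf (nOfX x) + nOfX x * mOf (nOfX x)) = 0 := by rw [h0]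
    omega
  rw [adjB_eq_true_iff (mOf (nOfX x)) (Nat.div_lt_of_lt_mul hk) (Nat.mod_lt _ hpos)]
  simp only [finProdFinEquiv_symm_apply]
  rfl

/-- **Value of the oracle query on a decodable input**: the canonical counting query for the
blow-up at accuracy `8 kη`. [cite: DyerEtAl2003, Lemma 9 (proof)] -/
theorem queryW_countQuery (hd : IsDec x) :
    queryW (countQuery x 0 kη kδ u) =
      countQuery (encodingGraph.encode
        ⟨nOfX x * mOf (nOfX x) + nOfX x * mOf (nOfX x), blowupFin (matOf x) (mOf (nOfX x))⟩) 0 (8 * kη) 1 [] := by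
  rw [queryW, fanoutFn_apply, fanoutFn_apply, fanoutFn_apply, fanoutFn_apply, graphW_countQuery kη kδ u hd,
    uK_countQuery, countQuery_eq]
  rfl

end Decodable


/-! ### The output stage: divide the oracle's answer by `(2^m − 1)^n` and round -/

/-- **The estimator** `(n, m, k, A) ↦ ⌊A (k+1) / (k (2^m − 1)^n)⌋`: the oracle's answer `A`,
inflated by its tolerance `1 + 1/k` and divided by the multiplicity `(2^m − 1)^n` of each downset
among the full independent sets. [cite: DyerEtAl2003, Lemma 9 (proof) and proof of Theorem 3] -/
def estim (p : ℕ × (ℕ × (ℕ × ℕ))) : ℕ :=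
  p.2.2.2 * (p.2.2.1 + 1) / (p.2.2.1 * (2 ^ p.2.1 - 1) ^ p.1)

open CodeFP in
/-- **The estimator is computed on codes in polynomial time** (`n, m, k` unary, `A` binary):
unary-to-binary conversions, a power with unary exponent, two products and a division
(`CodeFPArith.lean`). [cite: AroraBarak2009, §1.3] -/
theorem estim_codeFP : CodeFP (pairE unE (pairE unE (pairE unE natE))) natE estim := by
  have pn : CodeFP (pairE unE (pairE unE (pairE unE natE))) unE (fun p => p.1) := fst _ _
  have pm : CodeFP (pairE unE (pairE unE (pairE unE natE))) unE (fun p => p.2.1) :=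
    (fst _ _).comp (snd _ _)
  have pk : CodeFP (pairE unE (pairE unE (pairE unE natE))) unE (fun p => p.2.2.1) :=
    (fst _ _).comp ((snd _ _).comp (snd _ _))
  have pA : CodeFP (pairE unE (pairE unE (pairE unE natE))) natE (fun p => p.2.2.2) :=
    (snd _ _).comp ((snd _ _).comp (snd _ _))
  have num : CodeFP (pairE unE (pairE unE (pairE unE natE))) natE (fun p => p.2.2.2 * (p.2.2.1 + 1)) :=
    natMul.comp₂ pA (natOfUn.comp (unSucc.comp pk))
  have base : CodeFP (pairE unE (pairE unE (pairE unE natE))) natE (fun p => 2 ^ p.2.1 - 1) :=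
    (strVal.comp (strOfUn.comp pm)).congr fun p => by
      show bitsToNat (unE p.2.1) = 2 ^ p.2.1 - 1
      rw [unE_eq_ones, bitsToNat_ones]
  have den : CodeFP (pairE unE (pairE unE (pairE unE natE))) natE
      (fun p => p.2.2.1 * (2 ^ p.2.1 - 1) ^ p.1) :=
    natMul.comp₂ (natOfUn.comp pk) (natPow.comp₂ base pn)
  exact (natDiv.comp₂ num den).congr fun p => rfl

section Output

variable (arith : List Bool → List Bool)

/-- The record `⟨1ⁿ, ⟨1ᵐ, ⟨1ᵏ, bin A⟩⟩⟩` assembled from `z = ⟨w, a⟩` (`a` the oracle's answer,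
read through its canonical numeral `canonF a = bin (decodeNat a)`). [folklore] -/
def recZ : List Bool → List Bool :=
  fanoutFn (uN ∘ fstF) (fanoutFn (uM ∘ fstF) (fanoutFn (uK ∘ fstF) (canonF ∘ sndF)))

/-- **The output stage**: on a decodable instance the numeral of the estimate computed by `arith`
on the record, otherwise `ε = bin 0`. [cite: DyerEtAl2003, Lemma 9 (proof)] -/
def outZ : List Bool → List Bool := iteFn (validW ∘ fstF) (arith ∘ recZ) fun _ => []

/-- `recZ ∈ FP`. [folklore] -/
theorem recZ_mem_FP : recZ ∈ FP :=
  fanoutFn_mem_FP (comp_mem_FP uN_mem_FP fstF_mem_FP) (fanoutFn_mem_FP (comp_mem_FP uM_mem_FP fstF_mem_FP)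
    (fanoutFn_mem_FP (comp_mem_FP uK_mem_FP fstF_mem_FP) (comp_mem_FP canonF_mem_FP sndF_mem_FP)))

variable {arith}

/-- `outZ arith ∈ FP` for `arith ∈ FP`. [folklore] -/
theorem outZ_mem_FP (harith : arith ∈ FP) : outZ arith ∈ FP :=
  iteFn_mem_FP (comp_mem_FP validW_mem_FP fstF_mem_FP) (comp_mem_FP harith recZ_mem_FP) (const_mem_FP _)

variable (arith)

/-- Value of `recZ` on a counting query paired with an answer. [folklore] -/
theorem recZ_countQuery {x : List Bool} (kη kδ : ℕ) (u a : List Bool) (hd : IsDec x) :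
    recZ (boolPair (countQuery x 0 kη kδ u) a) =
      CodeFP.pairE CodeFP.unE (CodeFP.pairE CodeFP.unE (CodeFP.pairE CodeFP.unE CodeFP.natE))
        (nOfX x, (mOf (nOfX x), (8 * kη, decodeNat a))) := by
  simp only [recZ, fanoutFn_apply, Function.comp_apply, fstF_boolPair, sndF_boolPair, uN_apply, uM_apply,
    uK_countQuery, nCap_eq kη kδ u hd, canonF_eq_encodeNat_decodeNat, CodeFP.pairE_apply, CodeFP.unE_eq_ones]

/-- **Value of the output stage on a decodable instance.** [folklore] -/
theorem outZ_countQuery_pos {x : List Bool} (kη kδ : ℕ) (u a : List Bool) (hd : IsDec x)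
    (hspec : ∀ p, arith (CodeFP.pairE CodeFP.unE (CodeFP.pairE CodeFP.unE (CodeFP.pairE CodeFP.unE CodeFP.natE)) p) =
      CodeFP.natE (estim p)) :
    outZ arith (boolPair (countQuery x 0 kη kδ u) a) =
      encodeNat (decodeNat a * (8 * kη + 1) / (8 * kη * (2 ^ mOf (nOfX x) - 1) ^ nOfX x)) := by
  rw [outZ, iteFn_apply_true (by rw [Function.comp_apply, fstF_boolPair, validW_countQuery, decide_eq_true hd]),
    Function.comp_apply, recZ_countQuery kη kδ u a hd, hspec]
  rfl

/-- Value of the output stage on an undecodable instance: `ε`. [folklore] -/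
theorem outZ_countQuery_neg {x : List Bool} (kη kδ : ℕ) (u a : List Bool) (hd : ¬ IsDec x) :
    outZ arith (boolPair (countQuery x 0 kη kδ u) a) = [] := by
  rw [outZ, iteFn_apply_false (by rw [Function.comp_apply, fstF_boolPair, validW_countQuery, decide_eq_false hd])]

end Output

/-! ### The oracle transducer: one query, then the output stage -/

section Machine

variable (arith : List Bool → List Bool)

/-- **The transducer of Lemma 9**: ask the one query `queryW w`, then output `outZ ⟨w, answer⟩`
(`OracleAlg.oneQuery` with the constant decision `1`). [cite: DyerEtAl2003, Lemma 9 (proof)] -/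
def lemma9Alg : OracleAlg (List Bool) :=
  OracleAlg.oneQuery (fun _ => [true]) queryW (fun _ => []) (outZ arith)

variable {arith}

/-- **The transducer is polynomial-time** (for a polynomial-time `arith`). [cite: AroraBarak2009, §3.4] -/
theorem lemma9Alg_isPolyTime (harith : arith ∈ FP) : (lemma9Alg arith).IsPolyTime (encodingList Bool) :=
  OracleAlg.isPolyTime_oneQuery _ _ _ _ (const_mem_FP _) (oneBit_const true) queryW_mem_FP (const_mem_FP _)
    (outZ_mem_FP harith)

variable (arith)

/-- The only query the transducer ever asks on `w` is `queryW w`. [folklore] -/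
theorem lemma9Alg_step_inl {w : List Bool} {E : List (List Bool)} {z : List Bool}
    (h : (lemma9Alg arith).step w E = Sum.inl z) : z = queryW w := by
  rcases E with _ | ⟨a, _ | ⟨b, E⟩⟩
  · simp only [lemma9Alg, OracleAlg.oneQuery, if_true, Sum.inl.injEq] at h
    exact h.symm
  · simp [lemma9Alg, OracleAlg.oneQuery] at h
  · simp [lemma9Alg, OracleAlg.oneQuery] at h

/-- **The run under an answer rule**: two rounds, output `outZ ⟨w, R ε (queryW w)⟩`. [folklore] -/
theorem lemma9Alg_runRule (w : List Bool) (R : OracleAlg.Rule) (j : ℕ) :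
    (lemma9Alg arith).runRule w R (j + 2) [] = some (outZ arith (boolPair w (R [] (queryW w)))) := by
  rw [OracleAlg.runRule_succ]
  simp only [lemma9Alg, OracleAlg.oneQuery, if_true, List.nil_append]
  rw [OracleAlg.runRule_succ]

end Machine


/-! ### The accuracy bookkeeping ("as in the proof of Theorem 3") -/

/-- `IsApproxCount` with denominators cleared: `n k ≤ N (k+1)` and `N k ≤ (k+1) n`. [folklore] -/
theorem isApproxCount_iff_mul {k : ℕ} (hk : 0 < k) (n N : ℕ) :
    IsApproxCount k n N ↔ n * k ≤ N * (k + 1) ∧ N * k ≤ (k + 1) * n := by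
  have hk' : (0 : ℝ) < k := by exact_mod_cast hk
  have e : (1 : ℝ) + 1 / k = (k + 1) / k := by field_simp
  unfold IsApproxCount
  rw [e, div_div_eq_mul_div, div_le_iff₀ (by positivity), div_mul_eq_mul_div, le_div_iff₀ hk']
  constructor
  · rintro ⟨h1, h2⟩
    constructor
    · exact_mod_cast h1
    · have h2' : (N : ℝ) * k ≤ (k + 1) * n := by linarith
      exact_mod_cast h2'
  · rintro ⟨h1, h2⟩
    constructor
    · exact_mod_cast h1
    · have h2' : ((N * k : ℕ) : ℝ) ≤ ((k + 1) * n : ℕ) := by exact_mod_cast h2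
      push_cast at h2'
      linarith

/-- **The rounding step.** If `K D ≤ T < K D + K/4` (the count `T` of independent sets against
the number `D ≥ 0` of downsets, `K = (2^m − 1)^n`), and `A` is within the factor `1 + 1/k` of `T`
with `k = 8 kη`, then `⌊A (k+1) / (k K)⌋` is within the factor `1 + 1/kη` of `D`: it is `≥ D`
because `A (k+1)/k ≥ T ≥ K D`, and either `4D + 1 ≤ k` and it is `< D + 1`, or `D ≥ 2 kη` and its
excess over `D` is at most `3D/k + 1 ≤ D/kη`. (The paper rounds to the nearest integer with
`δ = ε/21` and the cases `N ≤ 2/ε`, `N > 2/ε`.) [cite: DyerEtAl2003, proof of Theorem 3 (p. 6)] -/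
theorem estimate_isApproxCount {K D T A k kη : ℕ} (hK : 0 < K) (hkη : 0 < kη) (hk : k = 8 * kη)
    (h1 : K * D ≤ T) (h2 : 4 * (T - K * D) < K) (hA : IsApproxCount k T A) :
    IsApproxCount kη D (A * (k + 1) / (k * K)) := by
  have hkpos : 0 < k := by omega
  rw [isApproxCount_iff_mul hkpos] at hA
  obtain ⟨hA1, hA2⟩ := hA
  rw [isApproxCount_iff_mul hkη]
  set Y := A * (k + 1) / (k * K) with hY
  have hkK : 0 < k * K := Nat.mul_pos hkpos hK
  -- the lower bound `D ≤ Y`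
  have hDY : D ≤ Y := by
    rw [hY, Nat.le_div_iff_mul_le hkK]
    calc D * (k * K) = k * (K * D) := by ring
      _ ≤ k * T := Nat.mul_le_mul_left k h1
      _ = T * k := by ring
      _ ≤ A * (k + 1) := hA1
  -- the key upper inequality `4 k² Y < (k+1)² (4D+1)`
  have h3 : 4 * T < 4 * (K * D) + K := by
    obtain ⟨P, hP⟩ : ∃ P, P = K * D := ⟨_, rfl⟩
    rw [← hP] at h1 h2 ⊢
    omega
  have hYk : Y * (k * K) ≤ A * (k + 1) := Nat.div_mul_le_self _ _
  have key : 4 * k * k * Y < (k + 1) * (k + 1) * (4 * D + 1) := by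
    have h4 : 4 * k * k * Y * K ≤ 4 * (k + 1) * (k + 1) * T := by
      calc 4 * k * k * Y * K = 4 * k * (Y * (k * K)) := by ring
        _ ≤ 4 * k * (A * (k + 1)) := Nat.mul_le_mul_left _ hYk
        _ = 4 * (k + 1) * (A * k) := by ring
        _ ≤ 4 * (k + 1) * ((k + 1) * T) := Nat.mul_le_mul_left _ hA2
        _ = 4 * (k + 1) * (k + 1) * T := by ring
    have h5 : 4 * (k + 1) * (k + 1) * T < (k + 1) * (k + 1) * (4 * D + 1) * K := by
      have := Nat.mul_lt_mul_of_pos_left h3 (show 0 < (k + 1) * (k + 1) by positivity)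
      calc 4 * (k + 1) * (k + 1) * T = (k + 1) * (k + 1) * (4 * T) := by ring
        _ < (k + 1) * (k + 1) * (4 * (K * D) + K) := this
        _ = (k + 1) * (k + 1) * (4 * D + 1) * K := by ring
    exact Nat.lt_of_mul_lt_mul_right (lt_of_le_of_lt h4 h5)
  subst hk
  refine ⟨le_trans (Nat.mul_le_mul_right _ hDY) (Nat.mul_le_mul_left _ (Nat.le_succ _)), ?_⟩
  by_cases hsmall : 4 * D + 1 ≤ 8 * kη
  · -- small `D`: the estimate is exact from above, `Y ≤ D`
    have hYD : Y ≤ D := by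
      by_contra hlt
      have hge : D + 1 ≤ Y := by omega
      have h6 : 4 * (8 * kη) * (8 * kη) * (D + 1) < (8 * kη + 1) * (8 * kη + 1) * (4 * D + 1) :=
        lt_of_le_of_lt (Nat.mul_le_mul_left _ hge) key
      nlinarith [Nat.mul_le_mul_left (16 * kη) hsmall]
    calc Y * kη ≤ D * kη := Nat.mul_le_mul_right _ hYD
      _ ≤ (kη + 1) * D := by nlinarith
  · -- large `D ≥ 2 kη`: relative error
    rw [not_le] at hsmall
    by_contra hlt
    have hge : (kη + 1) * D + 1 ≤ Y * kη := by omega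
    have h6 : 4 * (8 * kη) * (8 * kη) * ((kη + 1) * D + 1) ≤ 4 * (8 * kη) * (8 * kη) * (Y * kη) :=
      Nat.mul_le_mul_left _ hge
    have h7 : 4 * (8 * kη) * (8 * kη) * (Y * kη) < (8 * kη + 1) * (8 * kη + 1) * (4 * D + 1) * kη := by
      have := Nat.mul_lt_mul_of_pos_right key hkη
      calc 4 * (8 * kη) * (8 * kη) * (Y * kη) = 4 * (8 * kη) * (8 * kη) * Y * kη := by ring
        _ < (8 * kη + 1) * (8 * kη + 1) * (4 * D + 1) * kη := this
    have hD2 : 2 * kη ≤ D := by omega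
    nlinarith [Nat.mul_le_mul_left (kη * kη) hD2, Nat.mul_le_mul_left (kη * D) hkη, Nat.mul_le_mul_left D hkη]


/-! ### The counting identities on code words, for the block size `2n + 3` -/

/-- The threshold `4 · 3^n < 2^{2n+3} − 1` holds for EVERY `n` (the printed block size `2n` needs
`n ≥ 5`; three more vertices per block remove the case distinction). [folklore] -/
theorem four_mul_three_pow_lt_mOf (n : ℕ) : 4 * 3 ^ n < 2 ^ mOf n - 1 := by
  have h1 : 3 ^ n ≤ 4 ^ n := Nat.pow_le_pow_left (by norm_num) n
  have h2 : 2 ^ mOf n = 8 * 4 ^ n := by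
    rw [mOf, pow_add, pow_mul]; norm_num; ring
  have h3 : 1 ≤ 4 ^ n := Nat.one_le_pow _ _ (by norm_num)
  omega

/-- **The two-sided estimate of Lemma 9 on code words**: with `K = (2^m − 1)^n`,
`D = downsetCount ⟨n, M⟩` and `T = bisCount ⟨2nm, blowupFin M m⟩`, `K D ≤ T` and `4 (T − K D) < K`
as soon as `4 · 3^n < 2^m − 1` (`card_indep_sub_lt` of `BISDownsetsBlowup.lean`, transferred as
in `downsetCount_encode_eq_bisCount_blowup_div`). [cite: DyerEtAl2003, Lemma 9 (proof)] -/
theorem bisCount_blowupFin_bounds {n : ℕ} (M : Fin n → Fin n → ℕ) {m : ℕ} (h : 4 * 3 ^ n < 2 ^ m - 1) :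
    (2 ^ m - 1) ^ n * downsetCount (encodingNatMatrix.encode ⟨n, M⟩) ≤
        bisCount (encodingGraph.encode ⟨n * m + n * m, blowupFin M m⟩) ∧
      4 * (bisCount (encodingGraph.encode ⟨n * m + n * m, blowupFin M m⟩) -
          (2 ^ m - 1) ^ n * downsetCount (encodingNatMatrix.encode ⟨n, M⟩)) < (2 ^ m - 1) ^ n := by
  classical
  have h1 := card_indepSets_comap_equiv (blowup (matrixRel M) m) (blowupFinEquiv n m)
  have h2 := card_indep_sub_lt (matrixRel M) m (matrixRel_refl M) (by simpa using h)
  simp only [Fintype.card_fin] at h2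
  have hL : downsetCount (encodingNatMatrix.encode ⟨n, M⟩) =
      (univ.filter fun D : Finset (Fin n) => IsLowerFinset (matrixRel M) D).card := by
    rw [downsetCount_encode_eq_card]
    congr 1
    ext D
    simp only [Finset.mem_filter, Finset.mem_univ, true_and]
    exact (isLowerFinset_matrixRel_iff M D).symm
  have hR : bisCount (encodingGraph.encode ⟨n * m + n * m, blowupFin M m⟩) =
      (univ.filter fun S : Finset (BlowupVertex (Fin n) m) =>
        IsBlowupIndep (matrixRel M) m S).card := by
    rw [bisCount_encode_of_colorable (blowupFin_colorable_two M m)]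
    refine Eq.trans ?_ (h1.trans ?_)
    · congr 1
      ext S
      simp only [Finset.mem_filter, Finset.mem_univ, true_and]
      rfl
    · congr 1
      ext S
      simp only [Finset.mem_filter, Finset.mem_univ, true_and]
      rfl
  rw [hL, hR]
  exact h2

/-- `downsetCount` of a decodable string is that of the code of the decoded matrix. [folklore] -/
theorem downsetCount_of_isDec {x : List Bool} (hd : IsDec x) :
    downsetCount x = downsetCount (encodingNatMatrix.encode ⟨nOfX x, matOf x⟩) := by
  rw [downsetCount_encode]
  unfold downsetCount
  rw [decode_eq, if_pos hd]
  rfl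

/-- `downsetCount` of an undecodable string is `0`. [folklore] -/
theorem downsetCount_of_not_isDec {x : List Bool} (hd : ¬ IsDec x) : downsetCount x = 0 := by
  unfold downsetCount
  rw [decode_eq, if_neg hd]
  rfl

/-- `decodeNat ε = 0`. [folklore] -/
theorem decodeNat_nil' : decodeNat ([] : List Bool) = 0 := (decodeNat_eq_zero_iff _).2 rfl

/-! ### Assembly -/

/-- **`#DOWNSETS ≤_AP #BIS` in the tree's transcript model** (the content of
`DownsetsAPReducibleBIS_holds`): the transducer `lemma9Alg`, with the estimator of `estim_codeFP`,
is a coin-free single-query AP-reduction (`APReducible.intro_of_forall`).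
[cite: DyerEtAl2003, Lemma 9 and Theorem 5] -/
theorem apReducible_downsetCount_bisCount : APReducible downsetCount bisCount := by
  obtain ⟨arith, harith, hspec⟩ := estim_codeFP
  obtain ⟨s, hs⟩ := exists_poly_length_le_of_mem_FP queryW_mem_FP
  refine APReducible.intro_of_forall (lemma9Alg arith) (lemma9Alg_isPolyTime harith) (s + C 2) ?_ ?_
  · intro w E z hz
    rw [lemma9Alg_step_inl arith hz, eval_add, eval_C]
    exact (hs w).trans (Nat.le_add_right _ _)
  · intro x kη kδ u R hkη hkδ hR
    rw [eval_add, eval_C, lemma9Alg_runRule]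
    refine ⟨_, rfl, ?_⟩
    by_cases hd : IsDec x
    · -- decodable instance: one query about the blow-up, divide, round
      rw [outZ_countQuery_pos arith kη kδ u _ hd hspec, decode_encodeNat, downsetCount_of_isDec hd]
      have hans := hR [] (encodingGraph.encode
        ⟨nOfX x * mOf (nOfX x) + nOfX x * mOf (nOfX x), blowupFin (matOf x) (mOf (nOfX x))⟩) (8 * kη) (by omega)
      rw [← queryW_countQuery kη kδ u hd] at hans
      obtain ⟨hb1, hb2⟩ := bisCount_blowupFin_bounds (matOf x) (four_mul_three_pow_lt_mOf (nOfX x))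
      exact estimate_isApproxCount (pow_pos (lt_of_le_of_lt (Nat.zero_le _) (four_mul_three_pow_lt_mOf (nOfX x))) _)
        hkη rfl hb1 hb2 hans
    · -- undecodable instance: the count is `0`, the output `ε`
      rw [outZ_countQuery_neg arith kη kδ u _ hd, downsetCount_of_not_isDec hd, decodeNat_nil']
      exact isApproxCount_self kη 0

end Lemma9Machine

/-- **Dyer–Goldberg–Greenhill–Jerrum 2003, Lemma 9 (with Theorem 5): `#DOWNSETS ≤_AP #BIS`,
discharged.** The named fact `DownsetsAPReducibleBIS` (`BISDownsets.lean`) holds: `downsetCount`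
is AP-reducible to `bisCount` by the single-query transducer of `Lemma9Machine` (blow every
point up into blocks `U_i`, `V_i` of size `2n + 3`, ask `#BIS` of the blown-up bipartite graph
once at accuracy `8 kη`, divide by `(2^{2n+3} − 1)^n` and round).
[cite: DyerEtAl2003, Lemma 9 and Theorem 5] -/
theorem DownsetsAPReducibleBIS_holds : DownsetsAPReducibleBIS :=
  Lemma9Machine.apReducible_downsetCount_bisCount

end DyerEtAl2003

end Literature.Computability.Complexity

end
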